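import Summits.CriticalPhenomena.PercolationContinuityZ3.Theorems.PercNearOneGluingNoHeavyLowerTailSahiThreeCopyCellF7p2222122Cells1

/-!
# `NoHeavyLowerTail` (crux stmt-CriticalPhenomena-4575), Sahi programme: ★★ `LawGood` for `F7` at class `2222122` — assembly of the Borda cells

Support file (Sahi cell, seat `prim-sahi-p1`, generation 65; `--supports stmt-CriticalPhenomena-4575`). [this work]
-/

namespace Summit.CriticalPhenomena.PercolationContinuityZ3.Theorems.SahiThreeCopy

open Finset Function Literature.Combinatorics.Sahi2008
open scoped BigOperators

/-- ★ Borda-cell facts for ALL 36 ordered cells of `F72222122`. [this work] -/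
theorem F72222122B_all : ∀ a b, a < 6 → b < 6 → F72222122B a b := by
  intro a b ha hb
  interval_cases a <;> interval_cases b
  exacts [F72222122c0_0, F72222122c0_1, F72222122c0_2, F72222122c0_3, F72222122c0_4, F72222122c0_5, F72222122c1_0, F72222122c1_1, F72222122c1_2, F72222122c1_3, F72222122c1_4, F72222122c1_5,
    F72222122c2_0, F72222122c2_1, F72222122c2_2, F72222122c2_3, F72222122c2_4, F72222122c2_5, F72222122c3_0, F72222122c3_1, F72222122c3_2, F72222122c3_3, F72222122c3_4, F72222122c3_5,
    F72222122c4_0, F72222122c4_1, F72222122c4_2, F72222122c4_3, F72222122c4_4, F72222122c4_5, F72222122c5_0, F72222122c5_1, F72222122c5_2, F72222122c5_3, F72222122c5_4, F72222122c5_5]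

/-- ★★ `PointwiseTP` for `F72222122` (Borda/chain cells). [this work] -/
theorem pointwiseTP_F72222122 : PointwiseTP 7 (prof7 111) (setInd F7set) := by
  rw [setInd_F7set_eq]; exact pointwiseTP_of_exists_cellFacts (by norm_num) _ F72222122B_all

/-- ★★ `LawGood` for `F72222122`. [this work] -/
theorem lawGood_F72222122 : LawGood 7 (prof7 111) (setInd F7set) :=
  lawGood_of_pointwiseTP pointwiseTP_F72222122

end Summit.CriticalPhenomena.PercolationContinuityZ3.Theorems.SahiThreeCopy
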